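import Summits.Langlands.Langlands.Theorems.SqrtFiveQuarticCoversBorelThreeDivisionPolynomial

/-!
# Route `SqrtFiveQuarticCovers` (crux `RefinedLocusModular`, stmt-Langlands-17833): a normaliser-of-
# split-Cartan mod-`3` framing (`s3`) forces a `K`-rational quadratic factor of `Ψ₃`

Companion of `…BorelThreeDivisionPolynomial` (p798920, `b3` ⇒ `K`-root of `Ψ₃`) and
`…BorelThreeHauptmodul` (p799099, `b3` ⇒ `K`-point of `X₀(3)`), for the OTHER level-`3` disjunct of
the route's cruxes: the `s3`-binder «`ρ̄₃(Γ_K) ⊆ C_s⁺(3) = ⟨diag(1,2), antidiag(1,1)⟩`» (hypothesis of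
`BoxBorelFive`, `ReductionToRefinedLocus`, and of RECORD v5's MODEL input `hNFw` for `CertS3H12`).

* `monomial_of_mem_closure_splitCartanThree` — every element of `⟨diag(1,2), antidiag(1,1)⟩ ≤ GL₂(𝔽₃)`
  is monomial: diagonal (`g₀₁ = g₁₀ = 0`) or anti-diagonal (`g₀₀ = g₁₁ = 0`) (closure induction);
* `exists_pair_roots_Ψ₃_of_splitCartanThree` — over a perfect field `K`, an `s3`-framing of `V[3]`
  gives two DISTINCT roots `x₁, x₂ ∈ K̄` of `Ψ₃(V)` with `x₁ + x₂, x₁x₂ ∈ K`: the framed points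
  `P₀ = e⁻¹(1,0)`, `P₁ = e⁻¹(0,1)` span the two lines of the split Cartan, every `σ` fixes or swaps the
  pair `{±P₀}, {±P₁}`, hence fixes or swaps `{x(P₀), x(P₁)}` (Galois descent on the symmetric functions);
* `exists_pair_roots_Ψ₃_of_splitCartanThree_framing` — the same for `E / 𝓞 K` over a number field with
  the cruxes' `s3`-binder VERBATIM.

So, for the route's framed curves: `b3` ⇒ `Ψ₃(E⊗K)` has a `K`-rational ROOT, `s3` ⇒ `Ψ₃(E⊗K)` has a
`K`-rational QUADRATIC FACTOR `X² − sX + p` with distinct roots (equivalently two `3`-isogenies defined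
over a quadratic extension and conjugate, the moduli meaning of a `K`-point of `X_s⁺(3)`).  Everything is
proved; no named fact.  HONEST STATUS: helper of stmt-Langlands-17833 toward its N1 debt; closes no stub,
moves no binder of RECORD v5; nothing here proves modularity of any curve.

References: J. H. Silverman, *The Arithmetic of Elliptic Curves*, GTM 106 (2009), III.§7, Ex. 3.7;
[FreitasLeHungSiksek2015] §2.2 (the curves `X(s3, ·)`).
-/

noncomputable section

set_option linter.dupNamespace false -- project-wide option (lakefile weak.linter.dupNamespace); `Summit.Langlands.Langlands` is the mandated namespace

open scoped Classical
open scoped Matrix NumberField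

namespace Summit.Langlands.Langlands.Theorems.SqrtFiveQuarticCovers

open WeierstrassCurve Literature.NumberTheory.GaloisRepresentations Polynomial

/-- **`C_s⁺(3)` is monomial.**  Every element of the subgroup of `GL₂(𝔽₃)` generated by `diag(1,2)`
and `antidiag(1,1)` (the normaliser of the split Cartan, order `8`) is a diagonal or an anti-diagonal
matrix.  Proof: closure induction (products and inverses of monomial `2 × 2` matrices are monomial).
[folklore] -/
theorem monomial_of_mem_closure_splitCartanThree {g : GL (Fin 2) (ZMod 3)}
    (hg : g ∈ Subgroup.closure
      ({(⟨!![1, 0; 0, 2], !![1, 0; 0, 2], by decide, by decide⟩ : GL (Fin 2) (ZMod 3)),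
        (⟨!![0, 1; 1, 0], !![0, 1; 1, 0], by decide, by decide⟩ : GL (Fin 2) (ZMod 3))} :
        Set (GL (Fin 2) (ZMod 3)))) :
    (((g : GL (Fin 2) (ZMod 3)) : Matrix (Fin 2) (Fin 2) (ZMod 3)) 0 1 = 0 ∧
        ((g : GL (Fin 2) (ZMod 3)) : Matrix (Fin 2) (Fin 2) (ZMod 3)) 1 0 = 0) ∨
      (((g : GL (Fin 2) (ZMod 3)) : Matrix (Fin 2) (Fin 2) (ZMod 3)) 0 0 = 0 ∧
        ((g : GL (Fin 2) (ZMod 3)) : Matrix (Fin 2) (Fin 2) (ZMod 3)) 1 1 = 0) := by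
  induction hg using Subgroup.closure_induction with
  | mem x hx =>
    simp only [Set.mem_insert_iff, Set.mem_singleton_iff] at hx
    rcases hx with rfl | rfl
    · left; exact ⟨rfl, rfl⟩
    · right; exact ⟨rfl, rfl⟩
  | one => left; simp
  | mul x y _ _ ihx ihy =>
    simp only [Units.val_mul, Matrix.mul_apply, Fin.sum_univ_two]
    rcases ihx with ⟨h1, h2⟩ | ⟨h1, h2⟩ <;> rcases ihy with ⟨h3, h4⟩ | ⟨h3, h4⟩
    · left; simp [h1, h2, h3, h4]
    · right; simp [h1, h2, h3, h4]
    · right; simp [h1, h2, h3, h4]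
    · left; simp [h1, h2, h3, h4]
  | inv x _ ih =>
    rw [Matrix.coe_units_inv, Matrix.inv_def, Matrix.adjugate_fin_two]
    rcases ih with ⟨h1, h2⟩ | ⟨h1, h2⟩
    · left; simp [h1, h2]
    · right; simp [h1, h2]

/-- **An `s3`-framing gives a `K`-rational pair of roots of `Ψ₃`.**  Let `K` be a perfect field, `V` a
Weierstrass curve over `K`, `ρ̄ : Γ_K →ₜ* GL₂(𝔽₃)` with an equivariant framing
`e : V[3](K̄) ≃+ 𝔽₃²` (`e (σ • P) = ρ̄(σ) *ᵥ e P`) and image in `C_s⁺(3) = ⟨diag(1,2), antidiag(1,1)⟩`.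
Then there are `x₁ ≠ x₂` in `K̄`, both roots of `Ψ₃(V)`, with `x₁ + x₂ ∈ K` and `x₁ x₂ ∈ K` — i.e.
`Ψ₃(V)` has the `K`-rational quadratic factor `(X − x₁)(X − x₂)`.  Proof: `P₀ = e⁻¹(1,0)`,
`P₁ = e⁻¹(0,1)` have order `3` (so their abscissae are roots of `Ψ₃`, the tree's
`addOrderOf_eq_three_iff_Ψ₃_eval_eq_zero`); `ρ̄(σ)` monomial (`monomial_of_mem_closure_splitCartanThree`)
means `σ` maps `P₀ ↦ ±P₀, P₁ ↦ ±P₁` or `P₀ ↦ ±P₁, P₁ ↦ ±P₀`, so `σ` fixes or swaps `x(P₀), x(P₁)`;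
Galois descent (`K̄^{Γ_K} = K`) on `x(P₀) + x(P₁)` and `x(P₀) x(P₁)`; `x(P₀) ≠ x(P₁)` since
`P₁ ∉ {±P₀}` (`e` is injective). [cite: SilvermanAEC2009, III.§7, Ex. 3.7] [cite: FreitasLeHungSiksek2015, §2.2] -/
theorem exists_pair_roots_Ψ₃_of_splitCartanThree {K : Type} [Field K] [PerfectField K]
    (V : WeierstrassCurve K) (ρ : FramedGaloisRep K (ZMod 3) 2)
    (e : V.geomTorsion ((3 : ℕ) : ℤ) ≃+ (Fin 2 → ZMod 3))
    (he : ∀ (σ : Field.absoluteGaloisGroup K) (P : V.geomTorsion ((3 : ℕ) : ℤ)),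
      e (σ • P) = ((ρ σ : GL (Fin 2) (ZMod 3)) : Matrix (Fin 2) (Fin 2) (ZMod 3)) *ᵥ (e P))
    (hS : ∀ σ : Field.absoluteGaloisGroup K, (ρ σ : GL (Fin 2) (ZMod 3)) ∈ Subgroup.closure
      ({(⟨!![1, 0; 0, 2], !![1, 0; 0, 2], by decide, by decide⟩ : GL (Fin 2) (ZMod 3)),
        (⟨!![0, 1; 1, 0], !![0, 1; 1, 0], by decide, by decide⟩ : GL (Fin 2) (ZMod 3))} :
        Set (GL (Fin 2) (ZMod 3)))) :
    ∃ x₁ x₂ : AlgebraicClosure K, x₁ ≠ x₂ ∧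
      (V.baseChange (AlgebraicClosure K)).Ψ₃.eval x₁ = 0 ∧
      (V.baseChange (AlgebraicClosure K)).Ψ₃.eval x₂ = 0 ∧
      x₁ + x₂ ∈ Set.range (algebraMap K (AlgebraicClosure K)) ∧
      x₁ * x₂ ∈ Set.range (algebraMap K (AlgebraicClosure K)) := by
  have hcases : ∀ b : ZMod 3, b = 0 ∨ b = 1 ∨ b = 2 := by decide
  have key3 : ∀ c : ZMod 3, (2 : ZMod 3) * c = -c := by decide
  haveI : IsGalois K (AlgebraicClosure K) := {}
  haveI : Fact (Nat.Prime 3) := ⟨Nat.prime_three⟩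
  -- the two basis vectors and the points they frame
  set v₀ : Fin 2 → ZMod 3 := Pi.single 0 1 with hv₀
  set v₁ : Fin 2 → ZMod 3 := Pi.single 1 1 with hv₁
  set P₀ : V.geomTorsion ((3 : ℕ) : ℤ) := e.symm v₀ with hP₀def
  set P₁ : V.geomTorsion ((3 : ℕ) : ℤ) := e.symm v₁ with hP₁def
  have heP₀ : e P₀ = v₀ := e.apply_symm_apply v₀
  have heP₁ : e P₁ = v₁ := e.apply_symm_apply v₁
  -- generic transfer: `e (σ • P) = c • e Q` forces `σ • P ∈ {Q, -Q}` (or `P = 0`)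
  have transfer : ∀ (σ : Field.absoluteGaloisGroup K) (P Q : V.geomTorsion ((3 : ℕ) : ℤ))
      (w : Fin 2 → ZMod 3), P ≠ 0 → e Q = w → ∀ c : ZMod 3, e (σ • P) = c • w →
      σ • P = Q ∨ σ • P = -Q := by
    intro σ P Q w hP hQw c h1
    rw [← hQw] at h1
    rcases hcases c with h0 | h1' | h2
    · exfalso
      rw [h0, zero_smul] at h1
      have h2 : σ • P = 0 := by
        apply e.injective
        rw [h1, map_zero]
      exact hP ((smul_eq_zero_iff_eq σ).1 h2)
    · left
      apply e.injective
      rw [h1, h1', one_smul]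
    · right
      apply e.injective
      rw [h1, map_neg, h2]
      ext i
      simp only [Pi.smul_apply, smul_eq_mul, Pi.neg_apply]
      exact key3 (e Q i)
  have hv₀0 : v₀ ≠ 0 := by
    intro h; have := congrFun h 0; rw [hv₀, Pi.single_eq_same] at this; exact one_ne_zero this
  have hv₁0 : v₁ ≠ 0 := by
    intro h; have := congrFun h 1; rw [hv₁, Pi.single_eq_same] at this; exact one_ne_zero this
  have hP₀0 : P₀ ≠ 0 := by
    intro h; apply hv₀0; rw [← heP₀, h, map_zero]
  have hP₁0 : P₁ ≠ 0 := by
    intro h; apply hv₁0; rw [← heP₁, h, map_zero]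
  -- columns of a monomial matrix
  have hcols : ∀ σ : Field.absoluteGaloisGroup K,
      (e (σ • P₀) = (((ρ σ : GL (Fin 2) (ZMod 3)) : Matrix (Fin 2) (Fin 2) (ZMod 3)) 0 0) • v₀ ∧
        e (σ • P₁) = (((ρ σ : GL (Fin 2) (ZMod 3)) : Matrix (Fin 2) (Fin 2) (ZMod 3)) 1 1) • v₁) ∨
      (e (σ • P₀) = (((ρ σ : GL (Fin 2) (ZMod 3)) : Matrix (Fin 2) (Fin 2) (ZMod 3)) 1 0) • v₁ ∧
        e (σ • P₁) = (((ρ σ : GL (Fin 2) (ZMod 3)) : Matrix (Fin 2) (Fin 2) (ZMod 3)) 0 1) • v₀) := by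
    intro σ
    rw [he, he, heP₀, heP₁]
    rcases monomial_of_mem_closure_splitCartanThree (hS σ) with ⟨h1, h2⟩ | ⟨h1, h2⟩
    · left
      constructor
      · ext i; fin_cases i <;> simp [hv₀, Matrix.mulVec, dotProduct, Fin.sum_univ_two, h2]
      · ext i; fin_cases i <;> simp [hv₁, Matrix.mulVec, dotProduct, Fin.sum_univ_two, h1]
    · right
      constructor
      · ext i; fin_cases i <;> simp [hv₀, hv₁, Matrix.mulVec, dotProduct, Fin.sum_univ_two, h1]
      · ext i; fin_cases i <;> simp [hv₀, hv₁, Matrix.mulVec, dotProduct, Fin.sum_univ_two, h2]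
  -- every `σ` fixes or swaps the pair `{±P₀}, {±P₁}`
  have hσ : ∀ σ : Field.absoluteGaloisGroup K,
      ((σ • P₀ = P₀ ∨ σ • P₀ = -P₀) ∧ (σ • P₁ = P₁ ∨ σ • P₁ = -P₁)) ∨
      ((σ • P₀ = P₁ ∨ σ • P₀ = -P₁) ∧ (σ • P₁ = P₀ ∨ σ • P₁ = -P₀)) := by
    intro σ
    rcases hcols σ with ⟨h0, h1⟩ | ⟨h0, h1⟩
    · exact Or.inl ⟨transfer σ P₀ P₀ v₀ hP₀0 heP₀ _ h0, transfer σ P₁ P₁ v₁ hP₁0 heP₁ _ h1⟩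
    · exact Or.inr ⟨transfer σ P₀ P₁ v₁ hP₀0 heP₁ _ h0, transfer σ P₁ P₀ v₀ hP₁0 heP₀ _ h1⟩
  -- the underlying geometric points
  have hQ₀0 : (P₀ : V.geomPoints) ≠ 0 := fun h => hP₀0 (Subtype.ext h)
  have hQ₁0 : (P₁ : V.geomPoints) ≠ 0 := fun h => hP₁0 (Subtype.ext h)
  have hord : ∀ P : V.geomTorsion ((3 : ℕ) : ℤ), (P : V.geomPoints) ≠ 0 →
      addOrderOf (P : V.geomPoints) = 3 := by
    intro P hP
    have h3 : (3 : ℕ) • (P : V.geomPoints) = 0 := by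
      rw [← natCast_zsmul]
      exact (Submodule.mem_torsionBy_iff _ _).1 P.2
    exact addOrderOf_eq_prime h3 hP
  -- name the underlying affine points
  obtain ⟨Q₀, hQ₀⟩ : ∃ Q : (V.baseChange (AlgebraicClosure K)).toAffine.Point, Q = (P₀ : V.geomPoints) :=
    ⟨_, rfl⟩
  obtain ⟨Q₁, hQ₁⟩ : ∃ Q : (V.baseChange (AlgebraicClosure K)).toAffine.Point, Q = (P₁ : V.geomPoints) :=
    ⟨_, rfl⟩
  rcases Q₀ with _ | ⟨x₀, y₀, h₀⟩
  · exact absurd hQ₀.symm hQ₀0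
  rcases Q₁ with _ | ⟨x₁, y₁, h₁⟩
  · exact absurd hQ₁.symm hQ₁0
  -- roots of `Ψ₃`
  have hΨ₀ : (V.baseChange (AlgebraicClosure K)).Ψ₃.eval x₀ = 0 := by
    have := hord P₀ hQ₀0
    rw [← hQ₀] at this
    exact (Literature.AlgebraicGeometry.PlaneCurves.addOrderOf_eq_three_iff_Ψ₃_eval_eq_zero _ h₀).1 this
  have hΨ₁ : (V.baseChange (AlgebraicClosure K)).Ψ₃.eval x₁ = 0 := by
    have := hord P₁ hQ₁0
    rw [← hQ₁] at this
    exact (Literature.AlgebraicGeometry.PlaneCurves.addOrderOf_eq_three_iff_Ψ₃_eval_eq_zero _ h₁).1 this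
  -- reading abscissae: `σ • R = S` or `σ • R = -S` forces `σ x(R) = x(S)`
  have absc : ∀ (σ : Field.absoluteGaloisGroup K) (R S : V.geomTorsion ((3 : ℕ) : ℤ))
      (xR yR xS yS : AlgebraicClosure K) (hR : (V.baseChange (AlgebraicClosure K)).toAffine.Nonsingular xR yR)
      (hS' : (V.baseChange (AlgebraicClosure K)).toAffine.Nonsingular xS yS),
      (Affine.Point.some xR yR hR : (V.baseChange (AlgebraicClosure K)).toAffine.Point) = (R : V.geomPoints) →
      (Affine.Point.some xS yS hS' : (V.baseChange (AlgebraicClosure K)).toAffine.Point) = (S : V.geomPoints) →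
      (σ • R = S ∨ σ • R = -S) →
      (show AlgebraicClosure K ≃ₐ[K] AlgebraicClosure K from σ) xR = xS := by
    intro σ R S xR yR xS yS hR hS' hRe hSe h
    have h' : (show AlgebraicClosure K ≃ₐ[K] AlgebraicClosure K from σ) •
          (show (V.baseChange (AlgebraicClosure K)).toAffine.Point from (R : V.geomPoints)) =
        (show (V.baseChange (AlgebraicClosure K)).toAffine.Point from (S : V.geomPoints)) ∨
        (show AlgebraicClosure K ≃ₐ[K] AlgebraicClosure K from σ) •
          (show (V.baseChange (AlgebraicClosure K)).toAffine.Point from (R : V.geomPoints)) =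
        -(show (V.baseChange (AlgebraicClosure K)).toAffine.Point from (S : V.geomPoints)) := by
      rcases h with h | h
      · left; exact congrArg (fun T : V.geomTorsion ((3 : ℕ) : ℤ) => (T : V.geomPoints)) h
      · right; exact congrArg (fun T : V.geomTorsion ((3 : ℕ) : ℤ) => (T : V.geomPoints)) h
    rw [← hRe, ← hSe] at h'
    rcases h' with h' | h'
    · rw [WeierstrassCurve.smul_def, Affine.Point.map_some] at h'
      exact (Affine.Point.some.inj h').1
    · rw [WeierstrassCurve.smul_def, Affine.Point.map_some, Affine.Point.neg_some] at h'
      exact (Affine.Point.some.inj h').1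
  -- `σ` fixes or swaps `x₀, x₁`
  have hx : ∀ σ : AlgebraicClosure K ≃ₐ[K] AlgebraicClosure K,
      (σ x₀ = x₀ ∧ σ x₁ = x₁) ∨ (σ x₀ = x₁ ∧ σ x₁ = x₀) := by
    intro σ
    rcases hσ σ with ⟨h0, h1⟩ | ⟨h0, h1⟩
    · exact Or.inl ⟨absc σ P₀ P₀ x₀ y₀ x₀ y₀ h₀ h₀ hQ₀ hQ₀ h0, absc σ P₁ P₁ x₁ y₁ x₁ y₁ h₁ h₁ hQ₁ hQ₁ h1⟩
    · exact Or.inr ⟨absc σ P₀ P₁ x₀ y₀ x₁ y₁ h₀ h₁ hQ₀ hQ₁ h0, absc σ P₁ P₀ x₁ y₁ x₀ y₀ h₁ h₀ hQ₁ hQ₀ h1⟩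
  have hsum : ∀ σ : AlgebraicClosure K ≃ₐ[K] AlgebraicClosure K, σ (x₀ + x₁) = x₀ + x₁ := by
    intro σ
    rw [map_add]
    rcases hx σ with ⟨h0, h1⟩ | ⟨h0, h1⟩
    · rw [h0, h1]
    · rw [h0, h1, add_comm]
  have hprod : ∀ σ : AlgebraicClosure K ≃ₐ[K] AlgebraicClosure K, σ (x₀ * x₁) = x₀ * x₁ := by
    intro σ
    rw [map_mul]
    rcases hx σ with ⟨h0, h1⟩ | ⟨h0, h1⟩
    · rw [h0, h1]
    · rw [h0, h1, mul_comm]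
  -- distinct abscissae: otherwise `P₁ = ±P₀`, contradicting the framing
  have hne : x₀ ≠ x₁ := by
    intro hx01
    have hy : y₁ = y₀ ∨ y₁ = (V.baseChange (AlgebraicClosure K)).toAffine.negY x₀ y₀ := by
      by_cases hy' : y₁ = (V.baseChange (AlgebraicClosure K)).toAffine.negY x₀ y₀
      · exact Or.inr hy'
      · exact Or.inl (Affine.Y_eq_of_Y_ne h₁.left h₀.left hx01.symm hy')
    have hPP : (P₁ : V.geomPoints) = (P₀ : V.geomPoints) ∨ (P₁ : V.geomPoints) = -(P₀ : V.geomPoints) := by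
      rw [← hQ₀, ← hQ₁]
      rcases hy with hy | hy
      · left
        show (Affine.Point.some x₁ y₁ h₁ : (V.baseChange (AlgebraicClosure K)).toAffine.Point) =
          Affine.Point.some x₀ y₀ h₀
        simp only [Affine.Point.some.injEq]; exact ⟨hx01.symm, hy⟩
      · right
        show (Affine.Point.some x₁ y₁ h₁ : (V.baseChange (AlgebraicClosure K)).toAffine.Point) =
          -Affine.Point.some x₀ y₀ h₀
        rw [Affine.Point.neg_some]
        simp only [Affine.Point.some.injEq]; exact ⟨hx01.symm, hy⟩
    have hPP' : P₁ = P₀ ∨ P₁ = -P₀ := by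
      rcases hPP with h | h
      · exact Or.inl (Subtype.ext h)
      · exact Or.inr (Subtype.ext h)
    have hvv : v₁ = v₀ ∨ v₁ = -v₀ := by
      rcases hPP' with h | h
      · left; rw [← heP₀, ← heP₁, h]
      · right; rw [← heP₀, ← heP₁, h, map_neg]
    rcases hvv with h | h
    · have := congrFun h 1
      rw [hv₀, hv₁, Pi.single_eq_same, Pi.single_eq_of_ne (by decide)] at this
      exact one_ne_zero this
    · have := congrFun h 1
      rw [hv₀, hv₁, Pi.single_eq_same, Pi.neg_apply, Pi.single_eq_of_ne (by decide), neg_zero] at this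
      exact one_ne_zero this
  refine ⟨x₀, x₁, hne, hΨ₀, hΨ₁, ?_, ?_⟩
  · exact (InfiniteGalois.mem_range_algebraMap_iff_fixed (x₀ + x₁)).mpr hsum
  · exact (InfiniteGalois.mem_range_algebraMap_iff_fixed (x₀ * x₁)).mpr hprod

/-- **The `s3`-binder of the route's cruxes forces a `K`-rational quadratic factor of `Ψ₃(E⊗K)`.**
For a number field `K`, `E / 𝓞 K`, and a framing `ρ̄` of `E[3]` with image in
`C_s⁺(3) = ⟨diag(1,2), antidiag(1,1)⟩` (the `s3`-disjunct of `BoxBorelFive` / `ReductionToRefinedLocus` /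
RECORD v5's `hNFw`, VERBATIM): `Ψ₃(E⊗K)` has two distinct roots in `K̄` whose sum and product lie in
`K`.  Proof: `exists_pair_roots_Ψ₃_of_splitCartanThree`.
[cite: SilvermanAEC2009, III.§7, Ex. 3.7] [cite: FreitasLeHungSiksek2015, §2.2] -/
theorem exists_pair_roots_Ψ₃_of_splitCartanThree_framing (K : Type) [Field K] [NumberField K]
    (E : WeierstrassCurve (𝓞 K))
    (h3 : ∃ ρ : Literature.NumberTheory.GaloisRepresentations.FramedGaloisRep K (ZMod 3) 2,
      (∃ e : (E.baseChange K).geomTorsion ((3 : ℕ) : ℤ) ≃+ (Fin 2 → ZMod 3),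
        ∀ (σ : Field.absoluteGaloisGroup K) (P : (E.baseChange K).geomTorsion ((3 : ℕ) : ℤ)),
          e (σ • P) = ((ρ σ : GL (Fin 2) (ZMod 3)) : Matrix (Fin 2) (Fin 2) (ZMod 3)) *ᵥ (e P)) ∧
      (∀ σ : Field.absoluteGaloisGroup K, (ρ σ : GL (Fin 2) (ZMod 3)) ∈ Subgroup.closure
        ({(⟨!![1, 0; 0, 2], !![1, 0; 0, 2], by decide, by decide⟩ : GL (Fin 2) (ZMod 3)),
          (⟨!![0, 1; 1, 0], !![0, 1; 1, 0], by decide, by decide⟩ : GL (Fin 2) (ZMod 3))} :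
          Set (GL (Fin 2) (ZMod 3))))) :
    ∃ x₁ x₂ : AlgebraicClosure K, x₁ ≠ x₂ ∧
      ((E.baseChange K).baseChange (AlgebraicClosure K)).Ψ₃.eval x₁ = 0 ∧
      ((E.baseChange K).baseChange (AlgebraicClosure K)).Ψ₃.eval x₂ = 0 ∧
      x₁ + x₂ ∈ Set.range (algebraMap K (AlgebraicClosure K)) ∧
      x₁ * x₂ ∈ Set.range (algebraMap K (AlgebraicClosure K)) := by
  obtain ⟨ρ, ⟨e, he⟩, hS⟩ := h3
  exact exists_pair_roots_Ψ₃_of_splitCartanThree (E.baseChange K) ρ e he hS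

end Summit.Langlands.Langlands.Theorems.SqrtFiveQuarticCovers

end
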